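import Summits.RiemannHypothesis.RiemannHypothesis.Theorems.PfPersistenceTwoParityIndexBound
import HarnessLib

/-!
# PF-persistence, cand-7 seat (pub-rhpf, gen 5), two-parity index ladder, part 2/3: the index language —
# `OddNegIndexAtLeast`, odd index `≤ K`, real index `≤ 2K`, odd level 1, appending parity families

pub-rhpf cell, candidate seat 7 (floating B), generation 5.  HONEST FRAMING (page 1 of everything in this
cell): a long-odds MECHANISM / RIGIDITY SEARCH around Weil's quadratic functional; NOTHING here claims,
approaches or conditionally proves RH.  Labels: PROVED = kernel-checked (this file, RH-free throughout);
CITED = in print (E. Bombieri, *Remarks on Weil's quadratic functional in the theory of prime numbers I*,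
Rend. Mat. Acc. Lincei (9) 11 (2000), Thm 8: the full form has one negative eigenvalue per off-line zero `γ` with
`Im γ > 0`, i.e. `2K` for `ζ`; Thm 9: `K` in EACH parity sector [Bombieri2000Weil]; H. Yoshida, Invent. Math. 110
(1992), Prop. 1 [Yoshida1992HermitianForms]); HYPOTHESIS = an explicit binder.

Notation: `Q = weilQuadratic` (untruncated), `ĝ = weilMellin g`, `𝒬 = {ρ : ζ(ρ) = 0 non-trivial, Re ρ > 1/2,
Im ρ > 0}` (quadrant representatives of off-line quadruples), `K = #𝒬`.  The M2 seat's packet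
(`PfPersistenceM2EvenSectorIndexBound/Lower/Exact`, `PfPersistenceM2RealSectorSecondLevel`) proved: EVEN negative
index on long windows `= K` (for `K < ∞`), the second EVEN level `⟺ K ≤ 1`, and levels 1 and 2 of the FULL REAL
form are RH-equivalent.  Its named residue (HOME/M2-ROUTE.md §11): the ODD halves and the full-form levels `≥ 3` —
supplied by this seat's three-part packet `PfPersistenceTwoParityIndexBound` (odd `≤ K`, real `≤ 2K`),
`PfPersistenceTwoParityIndexFamilies` (index language, appending parity families, lower halves) and
`PfPersistenceTwoParityIndexLevels` (the level hierarchy of the full real form; third level `⟺ K ≤ 1`).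

PROVED in this part (all RH-free): `OddNegIndexAtLeast n a` (odd twin of the M2 seat's `EvenNegIndexAtLeast`);
odd index `≤ 𝒬.encard` (`le_encard_quadrant_of_oddNegIndexAtLeast`), real index `≤ 2·𝒬.encard`
(`le_two_mul_encard_quadrant_of_realNegIndexAtLeast`) and their counted contrapositives; under RH no odd negative
direction; off RH odd (and even) index `≥ 1` on all long windows (Yoshida's odd witness / the even witness, tree,
NO finiteness hypothesis) and **odd level 1 is RH-equivalent** (`riemannHypothesis_iff_forall_not_oddNegIndexAtLeast_one`);
`Re Q(E + O) = Re Q(E) + Re Q(O)` and the APPENDING lemma `realNegIndexAtLeast_add_of_even_odd` (`m` even + `n` odd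
negative directions ⇒ `m + n` real ones); `RH ↔ 𝒬 = ∅`; and the real LOWER half with one odd direction
(`realNegIndexAtLeast_succ_of_finite`: `1 ≤ K < ∞`, `n ≤ K` ⇒ real index `≥ n + 1` on long windows — the M2 even
family plus ONE odd Yoshida direction).  Part 3 turns these into the level hierarchy of the full real form.
-/

noncomputable section

set_option linter.dupNamespace false

open Complex Filter Set MeasureTheory
open scoped Real Topology ComplexConjugate BigOperators

namespace Summit.RiemannHypothesis.RiemannHypothesis.Theorems.PfPersistenceParityIndex

open Literature.NumberTheory.LFunctions
open Literature.NumberTheory.LFunctions.WeilConverse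
open Literature.NumberTheory.LFunctions.ZetaZeros
open Summit.RiemannHypothesis.RiemannHypothesis.Theorems.PolarPerronFrobenius
  (evenNegativity_exists_even_real_neg)
open Summit.RiemannHypothesis.RiemannHypothesis.Theorems.PfPersistenceM2NegIndex

-- `𝒬` = the open quadrant of non-trivial zeros, `Re ρ > 1/2`, `Im ρ > 0` (one representative per off-line
-- quadruple); a NOTATION (not a definition), so every statement below is literally over the M2 seat's set.
set_option quotPrecheck false in
local notation "𝒬" => {ρ : ℂ | ρ ∈ riemannZetaNontrivialZeros ∧ 1 / 2 < ρ.re ∧ 0 < ρ.im}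

/-! ## D. The index language: odd index `≤ K`, real index `≤ 2K`, odd level 1, appending families -/

/-- "The ODD real Weil form has negative index at least `n` on the window `[-a, a]`": `n` odd, real-valued Weil
tests supported in `[-a, a]` on whose real span `Re Q` is negative definite (the odd twin of the M2 seat's
`EvenNegIndexAtLeast`). [cite: Bombieri2000Weil, Thm 9] -/
def OddNegIndexAtLeast (n : ℕ) (a : ℝ) : Prop :=
  ∃ g : Fin n → ℝ → ℂ, (∀ i, IsWeilTest (g i)) ∧ (∀ i (t : ℝ), g i (-t) = -g i t) ∧
    (∀ i (t : ℝ), (g i t).im = 0) ∧ (∀ i, tsupport (g i) ⊆ Icc (-a) a) ∧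
    ∀ c : Fin n → ℝ, c ≠ 0 → (weilQuadratic (fun t : ℝ ↦ ∑ i, (c i : ℂ) * g i t)).re < 0

/-- Monotonicity in the window. [folklore] -/
theorem OddNegIndexAtLeast.mono {n : ℕ} {a b : ℝ} (h : OddNegIndexAtLeast n a) (hab : a ≤ b) :
    OddNegIndexAtLeast n b := by
  obtain ⟨g, h1, h2, h3, h4, h5⟩ := h
  exact ⟨g, h1, h2, h3, fun i ↦ (h4 i).trans (Icc_subset_Icc (neg_le_neg hab) hab), h5⟩

/-- Odd negative directions are in particular real negative directions. [folklore] -/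
theorem OddNegIndexAtLeast.toReal {n : ℕ} {a : ℝ} (h : OddNegIndexAtLeast n a) :
    RealNegIndexAtLeast n a := by
  obtain ⟨g, h1, -, h3, h4, h5⟩ := h
  exact ⟨g, h1, h3, h4, h5⟩

/-- **Odd upper half**: negative odd index `≥ n` at some window forces at least `n` quadrant zeros.
[cite: Bombieri2000Weil, Thm 9 (odd part)] -/
theorem le_encard_quadrant_of_oddNegIndexAtLeast {n : ℕ} {a : ℝ} (h : OddNegIndexAtLeast n a) :
    (n : ℕ∞) ≤ Set.encard 𝒬 := by
  obtain ⟨g, h1, h2, h3, -, h5⟩ := h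
  simpa using card_le_encard_quadrant_of_negative_odd_family g h1 h2 h3 h5

/-- **Real upper half**: negative REAL index `≥ n` at some window forces `n ≤ 2·𝒬.encard`.
[cite: Bombieri2000Weil, Thm 8] -/
theorem le_two_mul_encard_quadrant_of_realNegIndexAtLeast {n : ℕ} {a : ℝ} (h : RealNegIndexAtLeast n a) :
    (n : ℕ∞) ≤ 2 * Set.encard 𝒬 := by
  obtain ⟨g, h1, h2, -, h4⟩ := h
  simpa using card_le_two_mul_encard_quadrant_of_negative_real_family g h1 h2 h4

/-- RH-free: at most `n` off-line quadruples forbid `n + 1` independent negative ODD directions at every window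
(in particular the odd second level, like the even one, is blind to a single quadruple). [cite: Bombieri2000Weil, Thm 9] -/
theorem not_oddNegIndexAtLeast_succ_of_encard_le {n : ℕ} (h : Set.encard 𝒬 ≤ n) (a : ℝ) :
    ¬ OddNegIndexAtLeast (n + 1) a := fun h2 ↦ by
  have h3 := (le_encard_quadrant_of_oddNegIndexAtLeast h2).trans h
  have h4 : n + 1 ≤ n := by exact_mod_cast h3
  omega

/-- RH-free: `2·𝒬.encard ≤ n` forbids `n + 1` independent negative REAL directions at every window.
[cite: Bombieri2000Weil, Thm 8] -/
theorem not_realNegIndexAtLeast_succ_of_two_mul_encard_le {n : ℕ} (h : 2 * Set.encard 𝒬 ≤ n) (a : ℝ) :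
    ¬ RealNegIndexAtLeast (n + 1) a := fun h2 ↦ by
  have h3 := (le_two_mul_encard_quadrant_of_realNegIndexAtLeast h2).trans h
  have h4 : n + 1 ≤ n := by exact_mod_cast h3
  omega

/-- Under RH the odd real Weil form has no negative direction at any window. [cite: Bombieri2000Weil, Thm 2] -/
theorem not_oddNegIndexAtLeast_succ_of_riemannHypothesis (hRH : RiemannHypothesis) (n : ℕ) (a : ℝ) :
    ¬ OddNegIndexAtLeast (n + 1) a :=
  fun h ↦ not_realNegIndexAtLeast_succ_of_riemannHypothesis hRH n a h.toReal

/-- Off RH: odd negative index `≥ 1` on all long windows (Yoshida's odd witness, tree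
`oddNegativityOffLine_exists_odd_real_neg`; NO finiteness hypothesis). [cite: Yoshida1992HermitianForms, Prop. 1] -/
theorem oddNegIndexAtLeast_one_of_not_riemannHypothesis (hRH : ¬ RiemannHypothesis) :
    ∃ A : ℝ, ∀ a : ℝ, A ≤ a → OddNegIndexAtLeast 1 a := by
  obtain ⟨g, hg, ho, hr, hneg⟩ := oddNegativityOffLine_exists_odd_real_neg hRH
  obtain ⟨A, hA⟩ := exists_tsupport_subset_Icc hg.2
  refine ⟨A, fun a ha ↦ ⟨fun _ ↦ g, fun _ ↦ hg, fun _ t ↦ ho t, fun _ t ↦ hr t,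
    fun _ ↦ hA.trans (Icc_subset_Icc (neg_le_neg ha) ha), fun c hc ↦ ?_⟩⟩
  have hc0 : c 0 ≠ 0 := fun h ↦ hc (funext fun i ↦ by fin_cases i; exact h)
  have e : (fun t : ℝ ↦ ∑ i : Fin 1, (c i : ℂ) * g t) = fun t : ℝ ↦ (c 0 : ℂ) * g t := by
    funext t
    simp
  rw [e, weilQuadratic_const_mul, Complex.normSq_ofReal, Complex.re_ofReal_mul]
  exact mul_neg_of_pos_of_neg (mul_self_pos.2 hc0) hneg

/-- Off RH: even negative index `≥ 1` on all long windows (the even witness, tree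
`evenNegativity_exists_even_real_neg`; NO finiteness hypothesis). [cite: Bombieri2000Weil, Thm 9] -/
theorem evenNegIndexAtLeast_one_of_not_riemannHypothesis (hRH : ¬ RiemannHypothesis) :
    ∃ A : ℝ, ∀ a : ℝ, A ≤ a → EvenNegIndexAtLeast 1 a := by
  obtain ⟨g, hg, he, hr, hneg⟩ := evenNegativity_exists_even_real_neg hRH
  obtain ⟨A, hA⟩ := exists_tsupport_subset_Icc hg.2
  refine ⟨A, fun a ha ↦ ⟨fun _ ↦ g, fun _ ↦ hg, fun _ t ↦ he t, fun _ t ↦ hr t,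
    fun _ ↦ hA.trans (Icc_subset_Icc (neg_le_neg ha) ha), fun c hc ↦ ?_⟩⟩
  have hc0 : c 0 ≠ 0 := fun h ↦ hc (funext fun i ↦ by fin_cases i; exact h)
  have e : (fun t : ℝ ↦ ∑ i : Fin 1, (c i : ℂ) * g t) = fun t : ℝ ↦ (c 0 : ℂ) * g t := by
    funext t
    simp
  rw [e, weilQuadratic_const_mul, Complex.normSq_ofReal, Complex.re_ofReal_mul]
  exact mul_neg_of_pos_of_neg (mul_self_pos.2 hc0) hneg

/-- **Odd level 1 is RH-equivalent** (Yoshida's odd criterion in index language): RH ⟺ no window carries an odd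
negative direction. [cite: Yoshida1992HermitianForms, Prop. 1] -/
theorem riemannHypothesis_iff_forall_not_oddNegIndexAtLeast_one :
    RiemannHypothesis ↔ ∀ a : ℝ, ¬ OddNegIndexAtLeast 1 a := by
  refine ⟨fun hRH a ↦ not_oddNegIndexAtLeast_succ_of_riemannHypothesis hRH 0 a, fun h ↦ ?_⟩
  by_contra hRH
  obtain ⟨A, hA⟩ := oddNegIndexAtLeast_one_of_not_riemannHypothesis hRH
  exact h A (hA A le_rfl)

/-- `Re Q(E + O) = Re Q(E) + Re Q(O)` for an even real Weil test `E` and an odd real Weil test `O`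
(parity sectors are `Q`-orthogonal; M2 `re_weilQuadratic_even_add_odd` at `c₁ = c₂ = 1`). [cite: Bombieri2000Weil, §7] -/
theorem re_weilQuadratic_add_of_even_odd {E O : ℝ → ℂ} (hE : IsWeilTest E) (hO : IsWeilTest O)
    (he : ∀ t : ℝ, E (-t) = E t) (ho : ∀ t : ℝ, O (-t) = -O t) (hrE : ∀ t : ℝ, (E t).im = 0)
    (hrO : ∀ t : ℝ, (O t).im = 0) :
    (weilQuadratic (fun t : ℝ ↦ E t + O t)).re = (weilQuadratic E).re + (weilQuadratic O).re := by
  have h := re_weilQuadratic_even_add_odd hE hO he ho hrE hrO 1 1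
  simp only [Complex.ofReal_one, one_mul, one_pow] at h
  exact h

/-- **Appending parity families.**  `m` negative even directions and `n` negative odd directions at the same window
give `m + n` negative REAL directions (`Re Q(E + O) = Re Q(E) + Re Q(O) < 0` unless both coefficient blocks vanish).
[cite: Bombieri2000Weil, Thm 8] -/
theorem realNegIndexAtLeast_add_of_even_odd {m n : ℕ} {a : ℝ} (hev : EvenNegIndexAtLeast m a)
    (hod : OddNegIndexAtLeast n a) : RealNegIndexAtLeast (m + n) a := by
  classical
  obtain ⟨g₁, h₁, he₁, hr₁, hs₁, hneg₁⟩ := hev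
  obtain ⟨g₂, h₂, ho₂, hr₂, hs₂, hneg₂⟩ := hod
  refine ⟨Fin.append g₁ g₂, fun i ↦ ?_, fun i t ↦ ?_, fun i ↦ ?_, fun c hc ↦ ?_⟩
  · refine Fin.addCases (fun i ↦ ?_) (fun j ↦ ?_) i
    · rw [Fin.append_left]; exact h₁ i
    · rw [Fin.append_right]; exact h₂ j
  · refine Fin.addCases (fun i ↦ ?_) (fun j ↦ ?_) i
    · rw [Fin.append_left]; exact hr₁ i t
    · rw [Fin.append_right]; exact hr₂ j t
  · refine Fin.addCases (fun i ↦ ?_) (fun j ↦ ?_) i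
    · rw [Fin.append_left]; exact hs₁ i
    · rw [Fin.append_right]; exact hs₂ j
  · -- split the coefficient vector into its even block `c₁` and odd block `c₂`
    set c₁ : Fin m → ℝ := fun i ↦ c (Fin.castAdd n i) with hc₁def
    set c₂ : Fin n → ℝ := fun j ↦ c (Fin.natAdd m j) with hc₂def
    have hE : IsWeilTest (fun t : ℝ ↦ ∑ i, (c₁ i : ℂ) * g₁ i t) := isWeilTest_combination g₁ h₁ c₁
    have hO : IsWeilTest (fun t : ℝ ↦ ∑ j, (c₂ j : ℂ) * g₂ j t) := isWeilTest_combination g₂ h₂ c₂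
    have hEeven : ∀ t : ℝ, (∑ i, (c₁ i : ℂ) * g₁ i (-t)) = ∑ i, (c₁ i : ℂ) * g₁ i t :=
      fun t ↦ by simp only [he₁]
    have hOodd : ∀ t : ℝ, (∑ j, (c₂ j : ℂ) * g₂ j (-t)) = -∑ j, (c₂ j : ℂ) * g₂ j t :=
      fun t ↦ by simp only [ho₂, mul_neg, Finset.sum_neg_distrib]
    have hEreal : ∀ t : ℝ, (∑ i, (c₁ i : ℂ) * g₁ i t).im = 0 := fun t ↦ by
      simp [Complex.im_sum, Complex.mul_im, hr₁]
    have hOreal : ∀ t : ℝ, (∑ j, (c₂ j : ℂ) * g₂ j t).im = 0 := fun t ↦ by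
      simp [Complex.im_sum, Complex.mul_im, hr₂]
    have e : (fun t : ℝ ↦ ∑ i, (c i : ℂ) * Fin.append g₁ g₂ i t) =
        fun t : ℝ ↦ (∑ i, (c₁ i : ℂ) * g₁ i t) + ∑ j, (c₂ j : ℂ) * g₂ j t := by
      funext t
      rw [Fin.sum_univ_add]
      simp only [Fin.append_left, Fin.append_right, hc₁def, hc₂def]
    rw [e, re_weilQuadratic_add_of_even_odd hE hO hEeven hOodd hEreal hOreal]
    have hsplit : c₁ ≠ 0 ∨ c₂ ≠ 0 := by
      by_contra h
      push Not at h
      apply hc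
      funext i
      refine Fin.addCases (fun i ↦ ?_) (fun j ↦ ?_) i
      · exact congrFun h.1 i
      · exact congrFun h.2 j
    have hE0 : c₁ = 0 → (weilQuadratic (fun t : ℝ ↦ ∑ i, (c₁ i : ℂ) * g₁ i t)).re = 0 := fun h0 ↦ by
      have hz : (fun t : ℝ ↦ ∑ i, (c₁ i : ℂ) * g₁ i t) = 0 := by
        funext t
        simp [h0]
      rw [hz, weilQuadratic_zero, Complex.zero_re]
    have hO0 : c₂ = 0 → (weilQuadratic (fun t : ℝ ↦ ∑ j, (c₂ j : ℂ) * g₂ j t)).re = 0 := fun h0 ↦ by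
      have hz : (fun t : ℝ ↦ ∑ j, (c₂ j : ℂ) * g₂ j t) = 0 := by
        funext t
        simp [h0]
      rw [hz, weilQuadratic_zero, Complex.zero_re]
    rcases eq_or_ne c₁ 0 with h10 | h10
    · have h20 : c₂ ≠ 0 := hsplit.resolve_left (not_not.2 h10)
      rw [hE0 h10, zero_add]
      exact hneg₂ c₂ h20
    · rcases eq_or_ne c₂ 0 with h20 | h20
      · rw [hO0 h20, add_zero]
        exact hneg₁ c₁ h10
      · exact add_neg (hneg₁ c₁ h10) (hneg₂ c₂ h20)

/-- A zero in the open quadrant refutes RH. [folklore] -/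
theorem not_riemannHypothesis_of_mem_quadrant {ρ : ℂ} (hz : ρ ∈ riemannZetaNontrivialZeros)
    (hre : 1 / 2 < ρ.re) : ¬ RiemannHypothesis := fun hRH ↦ by
  have h1 : ρ.re = 1 / 2 := hRH ρ (riemannZetaNontrivialZeros.zeta_eq_zero hz) (by
    rintro ⟨k, hk⟩
    have h1 : ρ.re = -2 * ((k : ℝ) + 1) := by rw [hk]; simp
    have h2 : (0 : ℝ) ≤ k := k.cast_nonneg
    linarith) (riemannZetaNontrivialZeros.ne_one hz)
  linarith

/-- Off RH the open quadrant is non-empty: `1 ≤ 𝒬.encard` (the even witness is a negative even direction, and one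
negative even direction needs one quadrant zero, M2 `le_encard_quadrant_of_evenNegIndexAtLeast`). RH-free bookkeeping.
[cite: Bombieri2000Weil, Thm 9] -/
theorem one_le_encard_quadrant_of_not_riemannHypothesis (hRH : ¬ RiemannHypothesis) : 1 ≤ Set.encard 𝒬 := by
  obtain ⟨A, hA⟩ := evenNegIndexAtLeast_one_of_not_riemannHypothesis hRH
  simpa using le_encard_quadrant_of_evenNegIndexAtLeast (hA A le_rfl)

/-- **RH ⟺ the open quadrant is empty** (every off-line quadruple has exactly one representative there). [folklore] -/
theorem riemannHypothesis_iff_quadrant_eq_empty : RiemannHypothesis ↔ 𝒬 = (∅ : Set ℂ) := by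
  constructor
  · intro hRH
    ext ρ
    simp only [mem_setOf_eq, mem_empty_iff_false, iff_false, not_and, not_lt]
    intro hρ hre
    exact absurd hRH (not_riemannHypothesis_of_mem_quadrant hρ hre)
  · intro h
    by_contra hRH
    have h1 := one_le_encard_quadrant_of_not_riemannHypothesis hRH
    rw [h, Set.encard_empty] at h1
    exact absurd h1 (by norm_num)

/-- **Real lower half, one odd direction** (RH-free given the binders): if `𝒬` is finite and NON-EMPTY, then for
every `n ≤ K` the full real form has negative index `≥ n + 1` on all long windows — the M2 seat's `n` negative even
directions (`evenNegIndexAtLeast_of_finite`) plus ONE odd Yoshida direction, appended.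
[cite: Bombieri2000Weil, Thm 8, Thm 9; Yoshida1992HermitianForms, Prop. 1] -/
theorem realNegIndexAtLeast_succ_of_finite (hfin : Set.Finite 𝒬) (hK : 1 ≤ hfin.toFinset.card) {n : ℕ}
    (hn : n ≤ hfin.toFinset.card) : ∃ A : ℝ, ∀ a : ℝ, A ≤ a → RealNegIndexAtLeast (n + 1) a := by
  obtain ⟨ρ, hρ⟩ := Finset.card_pos.1 (by omega : 0 < hfin.toFinset.card)
  rw [Set.Finite.mem_toFinset] at hρ
  have hRH : ¬ RiemannHypothesis := not_riemannHypothesis_of_mem_quadrant hρ.1 hρ.2.1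
  obtain ⟨A₁, hA₁⟩ := evenNegIndexAtLeast_of_finite hfin hn
  obtain ⟨A₂, hA₂⟩ := oddNegIndexAtLeast_one_of_not_riemannHypothesis hRH
  exact ⟨max A₁ A₂, fun a ha ↦ realNegIndexAtLeast_add_of_even_odd (hA₁ a ((le_max_left _ _).trans ha))
    (hA₂ a ((le_max_right _ _).trans ha))⟩

end Summit.RiemannHypothesis.RiemannHypothesis.Theorems.PfPersistenceParityIndex

end
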